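import Literature.AlgebraicGeometry.Resolution.BlowupSequencesExtensions
import Literature.AlgebraicGeometry.Resolution.BlowupSequencesRestrictMarked
import Literature.AlgebraicGeometry.Resolution.MarkedIdealsEtale
import HarnessLib

/-!
# Multiple blow-ups and resolutions of marked ideals restrict to open subschemes (BGMW 2011, Def. 3.1.5 Remark (1))

Topic: `Literature/AlgebraicGeometry/Resolution`. Layer of the decomposition of the named fact
`BierstoneGrigorievMilmanWlodarczyk2011_canonical` (`CanonicalResolution.lean`; Bierstone–
Grigoriev–Milman–Włodarczyk, arXiv:1206.3090, Thm. 8.0.5): its functoriality clause (2) — "For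
any étale morphism `φ : M' → M`, the induced sequence `(X'_i) = φ^*(X_i)` is an extension of the
canonical resolution of `(X', 𝓘', E', μ) := φ^*(X, 𝓘, E, μ)`" — presupposes that the induced
sequence `φ^*(X_i)` IS a multiple blow-up (Defs. 3.1.3–3.1.4) of the pulled-back marked ideal,
with the pulled-back transforms: Def. 3.1.5, Remark (1), "The definition of extension arises
naturally when we pass to open subsets of the ambient variety `X`". The one-step
compatibilities (orders, supports, controlled and strict transforms, regular centres, simple
normal crossings under étale/flat pull-back) are PROVED in `MarkedIdealsEtale.lean`, together
with the assembly for the `Prop`-level multiple blow-ups `IsMultipleBlowup`. The assembly for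
the DATA-level multiple blow-ups of `BlowupSequences.lean` (`CentreSeq`, `CentreSeq.restrict`,
`transformMarked`, `IsAdmissibleFor`, `IsResolutionOf`) along OPEN IMMERSIONS `j : U → X` — the
case of clause (ii) of the named fact — is `CentreSeq.transformMarked_restrict`,
`CentreSeq.IsAdmissibleFor.restrict` and `CentreSeq.IsResolutionOf.restrict` of
`BlowupSequencesRestrictMarked.lean` (imported here; stated for the restricted marked ideal
`⟨𝓘.comap j, E.map (·.comap j), μ⟩`, which is `MarkedIdeal.comap M j` of
`BlowupSequencesExtensions.lean` by definition). This file adds, all PROVED: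

* `MarkedIdeal.support_comap_of_isOpenImmersion`, `MarkedIdeal.transform_comap_of_isOpenImmersion`
  — the one-step statements of `MarkedIdealsEtale.lean` specialised to open immersions and to
  `MarkedIdeal.comap` (simple normal crossings and regular centres restrict by
  `HasSNCWith.comap_of_etale` and `Scheme.IsRegular.subscheme_comap_of_etale` of that file, used
  directly);
* `HasSNCWith.sublist`, `CentreSeq.IsAdmissibleFor.of_boundary_sublist` (`_nil`),
  `CentreSeq.IsResolutionOf.of_boundary_sublist` — **forgetting boundary divisors** (§4, Step 1a:
  a multiple blow-up of `(X, 𝓙, E, μ)` "can be considered as [a] multiple blow-up of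
  `(X, 𝓙, ∅, μ(𝓙))`"): admissibility and resolutions pass to sub-boundaries;
* `CentreSeq.CentresOver.allTrivial_of_empty`, `CentreSeq.IsAdmissibleFor.allTrivial_restrict`,
  `CentreSeq.IsAdmissibleFor.restrict_isExtensionOf_nil` — **off the support the sequence is
  trivial**: restricted to an open missing `V(𝓘)`, a multiple blow-up of `(X, 𝓘, E, μ)`, `μ ≥ 1`,
  consists of trivial steps, i.e. extends the empty sequence (the degenerate case of
  Thm. 8.0.5 (2)).

## Sources

* E. Bierstone, D. Grigoriev, P. Milman, J. Włodarczyk, arXiv:1206.3090 (arXiv numbering):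
  Defs. 3.1.1–3.1.5 and Remark (1) (p. 6); §3.2 (p. 6); §4 Step 1a (p. 11); Thm. 8.0.5 (2)
  (p. 23). [BierstoneGrigorievMilmanWlodarczyk2011]
* U. Görtz, T. Wedhorn, *Algebraic Geometry I*, 2nd ed. (2020), Prop. 13.91. [GortzWedhorn2020]

## Faithfulness notes

* Locally Noetherian hypotheses enter through the sectionwise description of colon ideal
  sheaves (`MarkedIdealsEtale.lean`, `MarkedIdealsLemmas.lean`); BGMW's schemes are varieties.
-/

noncomputable section

open CategoryTheory CategoryTheory.Limits AlgebraicGeometry TopologicalSpace Topology IsLocalRing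

namespace Literature.AlgebraicGeometry.Resolution

universe u

/-! ## One step: the statements of `MarkedIdealsEtale.lean` for open immersions and `MarkedIdeal.comap` -/

section OneStep

variable {X U : Scheme.{u}} (j : U ⟶ X) [IsOpenImmersion j]

/-- **The support of the restriction of a marked ideal to an open subscheme is the trace of the
support**: `supp(j^*M) = j⁻¹(supp M)` (`MarkedIdeal.support_comap_of_etale`).
[cite: BierstoneGrigorievMilmanWlodarczyk2011, Def. 3.1.2 with Def. 3.1.5 Remark (1)] -/
theorem MarkedIdeal.support_comap_of_isOpenImmersion (M : MarkedIdeal X) :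
    (M.comap j).support = j ⁻¹' M.support :=
  MarkedIdeal.support_comap_of_etale j M _

variable {X' U' : Scheme.{u}} [IsLocallyNoetherian X'] [IsLocallyNoetherian U'] {π : X' ⟶ X}
  {π' : U' ⟶ U} (g : U' ⟶ X') [IsOpenImmersion g] (hsq : g ≫ π = π' ≫ j) (C : X.IdealSheafData)

include hsq in
omit [IsOpenImmersion j] in
/-- **The transform of a marked ideal restricts to the transform of the restricted marked ideal**
(BGMW Def. 3.1.3 (3)–(5) with Def. 3.1.5 Remark (1); `MarkedIdeal.transform_comap_of_flat`):
for a commutative square `g ≫ π = π' ≫ j` with `g` an open immersion (e.g. the cartesian square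
of the blow-ups over `j`, GW Prop. 13.91), `g^*((X, 𝓘, E, μ)') = (j^*(X, 𝓘, E, μ))'`, the
transforms taken along `π` with centre `C` and along `π'` with centre `j^*C`.
[cite: BierstoneGrigorievMilmanWlodarczyk2011, Def. 3.1.3 (3)–(5) with Def. 3.1.5 Remark (1)] -/
theorem MarkedIdeal.transform_comap_of_isOpenImmersion (M : MarkedIdeal X) :
    (M.transform π C).comap g = (M.comap j).transform π' (C.comap j) :=
  (MarkedIdeal.transform_comap_of_flat j hsq M C).symm

end OneStep

/-! ## Forgetting boundary divisors preserves simple normal crossings -/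

section SNC

variable {X : Scheme.{u}}

/-- **Forgetting boundary divisors preserves simple normal crossings**: if `C` has simple normal
crossings with `E`, it has simple normal crossings with every sublist of `E` (BGMW §4, Step 1a:
multiple blow-ups of `(X, 𝓙, E, μ)` "can be considered as multiple blow-ups of
`(X, 𝓙, ∅, μ(𝓙))`"). [cite: BierstoneGrigorievMilmanWlodarczyk2011, §4 Step 1a] -/
theorem HasSNCWith.sublist {E E' : List X.IdealSheafData} {C : X.IdealSheafData}
    (hE : E'.Sublist E) (h : HasSNCWith E C) : HasSNCWith E' C := by
  intro x
  obtain ⟨hreg, u, hu, ⟨ι, hι, hιD⟩, hC⟩ := h x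
  refine ⟨hreg, u, hu, ⟨fun D => ι ⟨D.1, hE.subset D.2.1, D.2.2⟩, fun D₁ D₂ heq => ?_,
    fun D => hιD ⟨D.1, hE.subset D.2.1, D.2.2⟩⟩, hC⟩
  have := congrArg Subtype.val (hι heq)
  exact Subtype.ext this

/-- The boundary alone: `HasSNCWith E C → HasSNC E`. [folklore] -/
theorem HasSNCWith.hasSNC {E : List X.IdealSheafData} {C : X.IdealSheafData} (h : HasSNCWith E C) :
    HasSNC E := by
  intro x
  obtain ⟨hreg, u, hu, hE, -⟩ := h x
  refine ⟨hreg, u, hu, hE, fun hx => ?_⟩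
  have hx' : x ∈ ((⊤ : X.IdealSheafData).support : Set X) := hx
  rw [Scheme.IdealSheafData.support_top, TopologicalSpace.Closeds.coe_bot] at hx'
  exact (Set.notMem_empty x hx').elim

end SNC

/-! ## Forgetting boundary divisors (BGMW §4, Step 1a) -/

namespace CentreSeq

variable {X U : Scheme.{u}}

/-- The transforms of two marked ideals with the same ideal and multiplicity have the same ideal
and multiplicity (the boundary does not enter the controlled transform). [folklore] -/
theorem transformMarked_ideal_eq : ∀ {X : Scheme.{u}} (s : CentreSeq X) (M N : MarkedIdeal X),
    M.ideal = N.ideal → M.mult = N.mult →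
      (s.transformMarked M).ideal = (s.transformMarked N).ideal ∧
        (s.transformMarked M).mult = (s.transformMarked N).mult
  | _, nil _, _, _, hI, hμ => ⟨hI, hμ⟩
  | _, cons C rest, M, N, hI, hμ => by
    refine transformMarked_ideal_eq rest _ _ ?_ hμ
    rw [MarkedIdeal.transform_ideal, MarkedIdeal.transform_ideal, hI, hμ]

/-- Hence they have the same support. [folklore] -/
theorem transformMarked_support_eq (s : CentreSeq X) {M N : MarkedIdeal X} (hI : M.ideal = N.ideal)
    (hμ : M.mult = N.mult) : (s.transformMarked M).support = (s.transformMarked N).support := by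
  obtain ⟨h1, h2⟩ := transformMarked_ideal_eq s M N hI hμ
  unfold MarkedIdeal.support
  rw [h1, h2]

/-- **Admissibility w.r.t. a boundary implies admissibility w.r.t. any sub-boundary** (BGMW §4,
Step 1a: a multiple blow-up of `(X, 𝓙, E, μ)` "can be considered as [a] multiple blow-up of
`(X, 𝓙, ∅, μ(𝓙))`"): the supports do not see the boundary, simple normal crossings with a list of
divisors pass to sublists (`HasSNCWith.sublist`), and the transformed boundaries stay sublists.
[cite: BierstoneGrigorievMilmanWlodarczyk2011, §4 Step 1a] -/
theorem IsAdmissibleFor.of_boundary_sublist : ∀ {X : Scheme.{u}} (s : CentreSeq X)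
    {I : X.IdealSheafData} {E E' : List X.IdealSheafData} {μ : ℕ}, E'.Sublist E →
      s.IsAdmissibleFor ⟨I, E, μ⟩ → s.IsAdmissibleFor ⟨I, E', μ⟩
  | _, nil _, _, _, _, _, _, _ => trivial
  | _, cons C rest, I, E, E', μ, hE, h => by
    obtain ⟨hsupp, hsnc, hC, hrest⟩ := h
    refine ⟨hsupp, hsnc.sublist hE, hC, ?_⟩
    have hE' : (E'.map (strictTransformIdeal (blowup.π C) C) ++ [C.comap (blowup.π C)]).Sublist
        (E.map (strictTransformIdeal (blowup.π C) C) ++ [C.comap (blowup.π C)]) :=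
      (hE.map _).append_right _
    exact IsAdmissibleFor.of_boundary_sublist rest hE' hrest

/-- In particular w.r.t. the empty boundary. [cite: BierstoneGrigorievMilmanWlodarczyk2011, §4 Step 1a] -/
theorem IsAdmissibleFor.of_boundary_nil (s : CentreSeq X) {I : X.IdealSheafData}
    {E : List X.IdealSheafData} {μ : ℕ} (h : s.IsAdmissibleFor ⟨I, E, μ⟩) :
    s.IsAdmissibleFor ⟨I, [], μ⟩ :=
  IsAdmissibleFor.of_boundary_sublist s (List.nil_sublist E) h

/-- **A resolution w.r.t. a boundary is a resolution w.r.t. any sub-boundary.**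
[cite: BierstoneGrigorievMilmanWlodarczyk2011, §4 Step 1a with Def. 3.1.3] -/
theorem IsResolutionOf.of_boundary_sublist (s : CentreSeq X) {I : X.IdealSheafData}
    {E E' : List X.IdealSheafData} {μ : ℕ} (hE : E'.Sublist E) (h : s.IsResolutionOf ⟨I, E, μ⟩) :
    s.IsResolutionOf ⟨I, E', μ⟩ :=
  ⟨IsAdmissibleFor.of_boundary_sublist s hE h.1,
    (transformMarked_support_eq s (M := ⟨I, E', μ⟩) (N := ⟨I, E, μ⟩) rfl rfl).trans h.2⟩

/-! ## Off the support -/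

/-- A sequence all of whose centres lie over the empty set consists of trivial steps. [folklore] -/
theorem CentresOver.allTrivial_of_empty : ∀ {X : Scheme.{u}} (s : CentreSeq X),
    s.CentresOver ∅ → s.AllTrivial
  | _, nil _, _ => trivial
  | _, cons C rest, h => by
    obtain ⟨hC, hrest⟩ := h
    refine ⟨(Scheme.IdealSheafData.support_eq_bot_iff C).mp ?_,
      CentresOver.allTrivial_of_empty rest ?_⟩
    · refine le_bot_iff.mp fun x hx => ?_
      exact (hC hx).elim
    · rwa [Set.preimage_empty] at hrest

/-- **Off the support the sequence is trivial**: the restriction of a multiple blow-up of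
`M = (X, 𝓘, E, μ)`, `μ ≥ 1`, to an open subscheme `U` missing `V(𝓘)` consists of trivial steps
(all centres lie over `V(𝓘)`, `IsAdmissibleFor.centresOver`) — the degenerate case of BGMW
Thm. 8.0.5 (2), where `j^*(X, 𝓘, E, μ)` has empty support and the empty canonical resolution.
[cite: BierstoneGrigorievMilmanWlodarczyk2011, Def. 3.1.3 (1) with Def. 3.1.5 Remark (1)] -/
theorem IsAdmissibleFor.allTrivial_restrict {s : CentreSeq X} {M : MarkedIdeal X}
    (h : s.IsAdmissibleFor M) (hμ : 1 ≤ M.mult) (j : U ⟶ X) [IsOpenImmersion j]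
    (hj : j ⁻¹' (M.ideal.support : Set X) = ∅) : (s.restrict j).AllTrivial :=
  CentresOver.allTrivial_of_empty _
    (hj ▸ CentresOver.restrict s j (IsAdmissibleFor.centresOver s M h hμ))

/-- In particular such a restriction is an extension of the EMPTY sequence, the (canonical)
resolution of a marked ideal with empty support. [cite: BierstoneGrigorievMilmanWlodarczyk2011, Thm. 8.0.5 (2) (degenerate case)] -/
theorem IsAdmissibleFor.restrict_isExtensionOf_nil {s : CentreSeq X} {M : MarkedIdeal X}
    (h : s.IsAdmissibleFor M) (hμ : 1 ≤ M.mult) (j : U ⟶ X) [IsOpenImmersion j]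
    (hj : j ⁻¹' (M.ideal.support : Set X) = ∅) : (s.restrict j).IsExtensionOf (nil U) :=
  (isExtensionOf_nil_iff _).mpr (h.allTrivial_restrict hμ j hj)

end CentreSeq

end Literature.AlgebraicGeometry.Resolution

end
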